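import Mathlib
import Summits.ValiantsHypothesis.ValiantsHypothesis.Theorems.BarrierLeverSuccinctHittingSetsForVPCatalecticantThree
import Summits.ValiantsHypothesis.ValiantsHypothesis.Theorems.BarrierLeverSuccinctHittingSetsForVPPrincipalMinorsTwoLinear
import HarnessLib

/-!
# Crux `BarrierLever.DefinableEquations` (stmt-ValiantsHypothesis-8745) / item 8749
`SingleSizeEquations` — the CATALECTICANT WALL: no Boolean-sum witness is a principal catalecticant
minor (any size at `b ≥ 3`; size `< n` at the open rung `b = 2`)

Seat val-np-p5 g17 (docket 8745/8746/8749). In the crux's own currency — a witness of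
`SingleSizeEquations` at `(n, b)` is a Boolean sum `E = boolSum H ≠ 0` in the `N = C(2n,n)` coefficient
variables vanishing at `coeff(f)` for every `f ∈ SmallCircuits ℂ n b` — this file records what the
14610-side rows landed today (`…CatalecticantThree`, `…PrincipalMinorsTwoLinear`) say about the SHAPE
of such a witness:

* `boolSum_witness_not_principalMinor` : for `n ≥ 6`, `b ≥ 3`, NO witness `E` (any `q`, any size and
  degree of `H`) is, as a function of the coefficient vector, a principal catalecticant minor
  `f ↦ det [coeff_{u_i+u_j} f]_{i,j ∈ ι}` (`u` injective, `2|u_i| ≤ n`; any size, any mixture of row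
  degrees) — because ONE member of `SmallCircuits ℂ n 3` (the factorial polynomial, a Gram /
  positive-definite witness) makes every such minor nonzero (`principalMinorsHit_of_three_le`);
* `boolSum_witness_not_principalMinor_two` : at the OPEN rung `b = 2` (indeed every `b ≥ 2`, `n ≥ 1`)
  the same holds for minors of size `|ι| + 1 ≤ n` (`principalMinorsLinear_two`: sparse diagonal
  witness `Σ_k t^{‖u_k‖²} x^{2u_k}` + parallelogram law).

So the door "E a principal catalecticant minor" of the b = 2 door table (memo LANDSCAPE-8749-g16 §5 /
g17 §0) is CLOSED at `b ≥ 3` for every size and at `b = 2` for size `< n`; poly(N)-size catalecticant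
minors at `b = 2` remain open (conjecturally closed by `(1 + Σ x_l)^n` itself for the full slice
blocks — memo g17 §2, conjecture (S), certified numerics kit j307556).

Honest framing: a WALL (it excludes witnesses of a specific algebraic shape); the verdict on 8745/8749
is unchanged (OPEN at `b = 2`, Chatterjee–Tengse 2023 §1.3 direction 2); nothing here bears on
`VP ≠ VNP`.

References: [ForbesShpilkaVolk2018] §1.2 (rank methods are algebraically natural), Question 6;
[ChatterjeeTengse2023] §1.3.
-/

-- layout Summits/ValiantsHypothesis/ValiantsHypothesis forces the duplicated namespace component
set_option linter.dupNamespace false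

noncomputable section

namespace Summit.ValiantsHypothesis.ValiantsHypothesis.Theorems.BarrierLeverDefinableEquations

open Literature.Barriers.ValiantsHypothesis Literature.Computability.AlgebraicComplexity MvPolynomial
open Summit.ValiantsHypothesis.ValiantsHypothesis.Theorems.BarrierLever.SuccinctHittingSetsForVP

namespace CatalecticantWall

/-- **No Boolean-sum witness at `(n, b)`, `b ≥ 3`, `n ≥ 6`, is a principal catalecticant minor**
(any size, any selection of rows `u_i` with `2|u_i| ≤ n`). [cite: ForbesShpilkaVolk2018, §1.2] -/
theorem boolSum_witness_not_principalMinor {n b q : ℕ} (hn : 6 ≤ n) (hb : 3 ≤ b)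
    (H : MvPolynomial (degLEMonomials n ⊕ Fin q) ℂ) (hne : boolSum H ≠ 0)
    (hvan : ∀ f ∈ SmallCircuits ℂ n b,
      MvPolynomial.eval (coeffVector (degLEMonomials n) f) (boolSum H) = 0) :
    ¬ ∃ (ι : Type) (_ : Fintype ι) (_ : DecidableEq ι) (u : ι → (Fin n →₀ ℕ)),
        Function.Injective u ∧ (∀ i, 2 * (u i).degree ≤ n) ∧
        ∀ f : MvPolynomial (Fin n) ℂ,
          MvPolynomial.eval (coeffVector (degLEMonomials n) f) (boolSum H) =
            (Matrix.of fun i j : ι => MvPolynomial.coeff (u i + u j) f).det := by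
  intro hshape
  obtain ⟨f, hf, hf0⟩ := principalMinorsHit_of_three_le hn hb (boolSum H) hshape hne
  exact hf0 (hvan f hf)

/-- **At the open rung: no Boolean-sum witness at `(n, b)`, `b ≥ 2`, `n ≥ 1`, is a principal
catalecticant minor of size `< n`** (rows `u_i` injective with `2|u_i| ≤ n`, `|ι| + 1 ≤ n`).
[cite: ForbesShpilkaVolk2018, §1.2] -/
theorem boolSum_witness_not_principalMinor_two {n b q : ℕ} (hn : 1 ≤ n) (hb : 2 ≤ b)
    (H : MvPolynomial (degLEMonomials n ⊕ Fin q) ℂ) (hne : boolSum H ≠ 0)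
    (hvan : ∀ f ∈ SmallCircuits ℂ n b,
      MvPolynomial.eval (coeffVector (degLEMonomials n) f) (boolSum H) = 0) :
    ¬ ∃ (ι : Type) (_ : Fintype ι) (_ : DecidableEq ι) (u : ι → (Fin n →₀ ℕ)),
        Function.Injective u ∧ (∀ i, 2 * (u i).degree ≤ n) ∧ Fintype.card ι + 1 ≤ n ∧
        ∀ f : MvPolynomial (Fin n) ℂ,
          MvPolynomial.eval (coeffVector (degLEMonomials n) f) (boolSum H) =
            (Matrix.of fun i j : ι => MvPolynomial.coeff (u i + u j) f).det := by
  intro hshape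
  obtain ⟨f, hf, hf0⟩ := principalMinorsLinear_two n (boolSum H) hshape hne
  exact hf0 (hvan f (smallCircuits_mono ℂ hb hn hf))

/-- **Level form** (quantifiers of item 8749 at one rung): for `b ≥ 3` there is NO level `a`, threshold
`n₀ ≥ 6` and family of Boolean sums witnessing `SingleSizeEquations` at exponent `b` whose members are
principal catalecticant minors — whatever `a`, `q ≤ N^a`, size and degree. Stated as: any such family
member at `n ≥ 6` fails to vanish on `SmallCircuits ℂ n b`. [cite: ForbesShpilkaVolk2018, §1.2] -/
theorem principalMinor_boolSum_not_equation {n b q : ℕ} (hn : 6 ≤ n) (hb : 3 ≤ b)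
    (H : MvPolynomial (degLEMonomials n ⊕ Fin q) ℂ)
    (hshape : ∃ (ι : Type) (_ : Fintype ι) (_ : DecidableEq ι) (u : ι → (Fin n →₀ ℕ)),
        Function.Injective u ∧ (∀ i, 2 * (u i).degree ≤ n) ∧
        ∀ f : MvPolynomial (Fin n) ℂ,
          MvPolynomial.eval (coeffVector (degLEMonomials n) f) (boolSum H) =
            (Matrix.of fun i j : ι => MvPolynomial.coeff (u i + u j) f).det)
    (hne : boolSum H ≠ 0) :
    ∃ f ∈ SmallCircuits ℂ n b,
      MvPolynomial.eval (coeffVector (degLEMonomials n) f) (boolSum H) ≠ 0 :=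
  principalMinorsHit_of_three_le hn hb (boolSum H) hshape hne

end CatalecticantWall

end Summit.ValiantsHypothesis.ValiantsHypothesis.Theorems.BarrierLeverDefinableEquations

end
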